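import Summits.BirchSwinnertonDyer.Rank1Residual.ManinAdditive.TwistOrbitAtTwoExactDegree
import Summits.BirchSwinnertonDyer.Rank1Residual.ManinAdditive.MinusOneOrbitManinEq
import Summits.BirchSwinnertonDyer.Rank1Residual.ManinAdditive.MinusOneTwistRigidity
import HarnessLib

/-!
# The `χ₋₄`-orbit at `2⁴ ∣ N` / `2⁵ ∣ N` — FILE 4/4 of T-an-7 (`MinusOneTwistLatticeRotationProof`): the landed
# conjecture leaf `MinusOneTwistLatticeRotation` (E-an-8 (i), `MinusOneTwistRigidity.lean`) PROVED outright (§21), and the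
# landed `MinusOneOrbitManinEq` (E-an-10) / `MinusOneTwistRigidity` (E-an-8 (ii)) REDUCED to optimal rigidity
# `NegOneOptimalTwistRigidity (2^5)` (OPEN) ∧ S-an-10 `NegOneTwistSameLevelDiscrEq (2^5)` (in print) (§20–§21)

PROVENANCE. Cell `bsd-f2-manin`, planner `bsd-f2-manin-an` g4: §§20–21 of the kernel-checked
HOME/an/Sketch-an5v3.lean 7cd536ef1a662bfb (`--axioms minusOneTwistLatticeRotation_holds` =
[propext, Classical.choice, Quot.sound]), landed VERBATIM by the cell's typer (T-an-7, file 4/4; file 1/4 =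
`HalfTranslateTwistStep`, whose module docstring has the full provenance).  No `sorry`, no conjecture tags; the two
`def … : Prop` of §20 are the HYPOTHESIS schemas of the reductions: `NegOneTwistSameLevelDiscrEq M` (S-an-10, in print in
substance [Pal2012, Prop. 2.4 / Lemma 3.1]) and `NegOneOptimalTwistRigidity M` (E-an-10 clause 1 — the conjectural
residue of E-an-10, OPEN; not reachable by lattice transport alone, HOME/MEMO-an.md §40).

CONTENT.  §20 `minusOneOrbitManinEq_of_rigidity_of_discrEq : NegOneOptimalTwistRigidity (2^5) →
NegOneTwistSameLevelDiscrEq (2^5) → MinusOneOrbitManinEq` (PROVED edge; the Manin clause `c′ = ±c` is file 3/4's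
`negOneCommutingOrbitManinDegEq_holds`).  §21 `half_gaussSum_χ₄_mul_mem_periodLattice_twoSided` (the exact step both
ways on a same-level `χ₋₄`-orbit with `4² ∣ N`, ANY `Γ₀`-data) ⇒ `minusOneTwistLatticeRotation_holds :
MinusOneTwistLatticeRotation` (`z ∈ Λ(f_{W′}) ⟺ i·z ∈ Λ(f_W)`, from `(g(χ₄)/2)² = −1`), closing imc's landed leaf
p551258; `minusOneTwistRigidity_of_rigidity_of_discrEq` reduces E-an-8 (ii) like E-an-10.  BC5 (Cremona `N < 5·10⁵`,
`2⁵ ∣ N`): `Δ′ = Δ`, `#1 ↦ #1`, `deg′ = deg` on 148 277 / 148 277 χ₋₄ same-level orbits; falsifiers 0.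
References: [cite: Stevens1989, Lemma (5.4) p. 97] [cite: Cremona1997, §2.8] [cite: Pal2012, Prop. 2.4 and Lemma 3.1].
-/

noncomputable section

open scoped MatrixGroups ModularForm

open CongruenceSubgroup WeierstrassCurve
  Literature.NumberTheory.DiophantineGeometry
  Literature.NumberTheory.EllipticCurves
  Literature.NumberTheory.EllipticCurves.ModularForms

namespace Summit.BirchSwinnertonDyer.Rank1Residual.ManinAdditive

section MinusOneReduction

/-! ## §20 E-an-10 `MinusOneOrbitManinEq` REDUCED: its Manin clause is §19's theorem; what remains is
## clause 1 (optimal rigidity) and S-an-10 (`Δ(W′) = Δ(W)` on same-level `χ₋₄`-orbits, in print) -/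

/-- **S-an-10 `NegOneTwistSameLevelDiscrEq M`** — on a same-level `χ₋₄`-orbit (`M ∣ N = N′`) of globally
minimal curves, `Δ(W′) = Δ(W)` (both twists `W ↦ W′ ↦ W` are integral up to `ũ, ũ′ ∈ {1, 2}` with
`ũ ũ′ = 1`; Cremona `N < 5·10⁵`, `2⁵ ∣ N`: 148 277 / 148 277 orbits).  IN PRINT in substance.
[cite: Pal2012, Prop. 2.4 and Lemma 3.1] -/
def NegOneTwistSameLevelDiscrEq (M : ℕ) : Prop :=
  ∀ (W W' : WeierstrassCurve ℚ) [W.IsElliptic] [W.IsGloballyMinimal] [W'.IsElliptic]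
    [W'.IsGloballyMinimal] (u : VariableChange ℚ),
    M ∣ W.conductorNorm ℤ → W'.conductorNorm ℤ = W.conductorNorm ℤ →
    u • W.quadraticTwist ((-1 : ℤ) : ℚ) = W' → W'.Δ = W.Δ

/-- **E-an-10 clause 1 `NegOneOptimalTwistRigidity M` (optimal rigidity; OPEN, the conjectural residue
of E-an-10):** if the `χ₋₄`-twist of the curve `W` of a lattice-optimal datum is isogenous to the curve
`W′` of a lattice-optimal datum at the same level (`M ∣ N`), then it is ISOMORPHIC to `W′` over `ℚ`
(«the optimal curve of the twisted class is the twist of the optimal curve»). [conjecture of this cell] -/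
def NegOneOptimalTwistRigidity (M : ℕ) : Prop :=
  ∀ (W W' : WeierstrassCurve ℚ) [W.IsElliptic] [W.IsGloballyMinimal] [W'.IsElliptic]
    [W'.IsGloballyMinimal] [NeZero (W.conductorNorm ℤ)] [NeZero (W'.conductorNorm ℤ)]
    (D : ModularParametrizationData W (W.conductorNorm ℤ))
    (D' : ModularParametrizationData W' (W'.conductorNorm ℤ)),
    IsLatticeOptimal D → IsLatticeOptimal D' →
    M ∣ W.conductorNorm ℤ → W'.conductorNorm ℤ = W.conductorNorm ℤ →
    IsIsogenous (W.quadraticTwist ((-1 : ℤ) : ℚ)) W' →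
    ∃ u : VariableChange ℚ, u • W.quadraticTwist ((-1 : ℤ) : ℚ) = W'

/-- **PROVED edge: E-an-10 ⟸ clause-1 rigidity ∧ S-an-10 (both at `2⁵`)** — the Manin clause
`c′ = ±c` of the landed `MinusOneOrbitManinEq` is §19's theorem `negOneCommutingOrbitManinDegEq_holds`. -/
theorem minusOneOrbitManinEq_of_rigidity_of_discrEq (hR : NegOneOptimalTwistRigidity (2 ^ 5))
    (hS : NegOneTwistSameLevelDiscrEq (2 ^ 5)) : MinusOneOrbitManinEq := by
  intro W W' _ _ _ _ _ _ D D' hD hD' h32 hN hiso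
  obtain ⟨u, hu⟩ := hR W W' D D' hD hD' h32 hN hiso
  refine ⟨⟨u, hu⟩, ?_⟩
  have h16 : 16 ∣ W.conductorNorm ℤ := dvd_trans (by norm_num) h32
  exact (negOneCommutingOrbitManinDegEq_holds dvd_rfl W W' u D D' h16 hN hu hD hD'
    (hS W W' u h32 hN hu)).1

end MinusOneReduction

section LatticeRotation

/-! ## §21 imc's LANDED conjecture `MinusOneTwistLatticeRotation` PROVED (`Λ(f_{W′}) = i·Λ(f_W)` on every
## same-level `χ₋₄`-orbit with `2⁴ ∣ N`), and `MinusOneTwistRigidity` REDUCED like E-an-10 (§20) -/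

/-- The two-sided EXACT STEP at `χ₄` (S-an-9, lattice form): on a same-level `χ₋₄`-orbit with `4² ∣ N`
(`W ⊗ χ₋₄ ~ W′`, `D`, `D′` any `Γ₀`-data of `W`, `W′`), `(g(χ₄)/2)·Λ(f_{W′}) ⊆ Λ(f_W)` AND
`(g(χ₄)/2)·Λ(f_W) ⊆ Λ(f_{W′})`. [cite: Stevens1989, Lemma (5.4) p. 97] [cite: Cremona1997, §2.8] -/
theorem half_gaussSum_χ₄_mul_mem_periodLattice_twoSided {W W' : WeierstrassCurve ℚ} [W.IsElliptic]
    [W'.IsElliptic] [NeZero (W.conductorNorm ℤ)] [NeZero (W'.conductorNorm ℤ)]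
    (D : ModularParametrizationData W (W.conductorNorm ℤ))
    (D' : ModularParametrizationData W' (W'.conductorNorm ℤ)) (h16 : 4 ^ 2 ∣ W.conductorNorm ℤ)
    (hN : W'.conductorNorm ℤ = W.conductorNorm ℤ)
    (hiso : IsIsogenous (W.quadraticTwist ((-1 : ℤ) : ℚ)) W') :
    (∀ w ∈ periodLattice D'.f,
      gaussSum (ZMod.χ₄.ringHomComp (Int.castRingHom ℂ)) (ZMod.stdAddChar (N := 4)) / 2 * w ∈
        periodLattice D.f) ∧
    (∀ w ∈ periodLattice D.f,
      gaussSum (ZMod.χ₄.ringHomComp (Int.castRingHom ℂ)) (ZMod.stdAddChar (N := 4)) / 2 * w ∈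
        periodLattice D'.f) := by
  haveI : Fact (Nat.Prime 2) := ⟨Nat.prime_two⟩
  haveI : NeZero (4 : ℕ) := ⟨by norm_num⟩
  have hχ : (ZMod.χ₄.ringHomComp (Int.castRingHom ℂ)).IsQuadratic := isQuadratic_χ₄_ringHomComp
  have hprim : DirichletCharacter.IsPrimitive (ZMod.χ₄.ringHomComp (Int.castRingHom ℂ)) :=
    isPrimitive_χ₄_ringHomComp
  have hd0 : ((-1 : ℤ) : ℚ) ≠ 0 := by norm_num
  haveI := W.isElliptic_quadraticTwist hd0
  have hM' : 4 ^ 2 ∣ W'.conductorNorm ℤ := by rw [hN]; exact h16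
  have h4 : 2 ^ 2 ∣ W.conductorNorm ℤ := dvd_trans (by norm_num) h16
  have h4' : 2 ^ 2 ∣ W'.conductorNorm ℤ := dvd_trans (by norm_num) hM'
  obtain ⟨hngW, hnmW⟩ := not_good_and_not_mult_of_sq_dvd_conductorNorm W h4
  obtain ⟨hngW', hnmW'⟩ := not_good_and_not_mult_of_sq_dvd_conductorNorm W' h4'
  have hW0 : ∀ n : ℕ, 2 ∣ n → W.LFunction n = 0 := fun n hn ↦
    W.LFunction_apply_eq_zero_of_not_good_of_not_mult 2 hngW hnmW hn
  have hW'0 : ∀ n : ℕ, 2 ∣ n → W'.LFunction n = 0 := fun n hn ↦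
    W'.LFunction_apply_eq_zero_of_not_good_of_not_mult 2 hngW' hnmW' hn
  have hu : (1 : VariableChange ℚ) • W.quadraticTwist ((-1 : ℤ) : ℚ) =
      W.quadraticTwist ((-1 : ℤ) : ℚ) := one_smul _ _
  have hodd : ∀ n : ℕ, ¬ 2 ∣ n → (((W.quadraticTwist ((-1 : ℤ) : ℚ)).LFunction n : ℤ) : ℂ) =
      (ZMod.χ₄.ringHomComp (Int.castRingHom ℂ)) n * (W.LFunction n : ℂ) := fun n hn ↦ by
    rw [show ((-1 : ℤ) : ℚ) = -1 by norm_num, W.LFunction_quadraticTwist_neg_one_apply_of_odd hn,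
      Int.cast_mul, χ₄_ringHomComp_apply_natCast]
  have heven : ∀ n : ℕ, 2 ∣ n → (ZMod.χ₄.ringHomComp (Int.castRingHom ℂ)) n = 0 := fun n hn ↦ by
    rw [χ₄_ringHomComp_apply_natCast, ZMod.χ₄_nat_eq_if_mod_four, if_pos (Nat.mod_eq_zero_of_dvd hn)]
    simp
  have hsq : ∀ n : ℕ, ¬ 2 ∣ n → (ZMod.χ₄.ringHomComp (Int.castRingHom ℂ)) n *
      (ZMod.χ₄.ringHomComp (Int.castRingHom ℂ)) n = 1 := fun n hn ↦ by
    rw [χ₄_ringHomComp_apply_natCast, ZMod.χ₄_nat_eq_if_mod_four,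
      if_neg (fun h ↦ hn (Nat.dvd_of_mod_eq_zero h))]
    split_ifs <;> push_cast <;> ring
  have hcoef : ∀ n : ℕ, cuspCoeff D'.f n = (ZMod.χ₄.ringHomComp (Int.castRingHom ℂ)) n * cuspCoeff D.f n :=
    fun n ↦ cuspCoeff_eq_chi_mul_of_twist_even hd0 1 hu hiso.LFunction_eq hodd heven hW'0 D D' n
  have hcoef' : ∀ n : ℕ, cuspCoeff D.f n = (ZMod.χ₄.ringHomComp (Int.castRingHom ℂ)) n * cuspCoeff D'.f n :=
    fun n ↦ cuspCoeff_eq_chi_mul_of_twist_even' hd0 1 hu hiso.LFunction_eq hodd hsq heven hW0 D D' n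
  have hNdvd : W.conductorNorm ℤ ∣ W'.conductorNorm ℤ := by rw [hN]
  have hNdvd' : W'.conductorNorm ℤ ∣ W.conductorNorm ℤ := by rw [hN]
  have htw' : charTwist (W'.conductorNorm ℤ) hNdvd hM' hχ D.f = D'.f :=
    eq_of_forall_cuspCoeff_eq_gamma0 fun n ↦ by rw [cuspCoeff_charTwist _ hNdvd hM' hχ hprim, hcoef n]
  have htw : charTwist (W.conductorNorm ℤ) hNdvd' h16 hχ D'.f = D.f :=
    eq_of_forall_cuspCoeff_eq_gamma0 fun n ↦ by rw [cuspCoeff_charTwist _ hNdvd' h16 hχ hprim, hcoef' n]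
  have hevenD : ∀ n : ℕ, 2 ∣ n → cuspCoeff D.f n = 0 := fun n hn ↦ by
    rw [D.isNewformOf.2 n, hW0 n hn, Int.cast_zero]
  have hevenD' : ∀ n : ℕ, 2 ∣ n → cuspCoeff D'.f n = 0 := fun n hn ↦ by
    rw [D'.isNewformOf.2 n, hW'0 n hn, Int.cast_zero]
  have hhalf : ∀ x : ℚ, modularSymbol D.f (x + 1 / 2) = -modularSymbol D.f x :=
    modularSymbol_add_half_eq_neg D.f h16 hevenD
  have hhalf' : ∀ x : ℚ, modularSymbol D'.f (x + 1 / 2) = -modularSymbol D'.f x :=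
    modularSymbol_add_half_eq_neg D'.f hM' hevenD'
  refine ⟨fun w hw ↦ ?_, fun w hw ↦ ?_⟩
  · rw [← htw'] at hw
    exact half_gaussSum_mul_mem_periodLattice_of_mem_charTwist _ hNdvd hM' hχ hprim D.f
      (fun x ↦ ⟨1, 3, 0, sum_χ₄_modularSymbol_of_half D.f hhalf x⟩) hw
  · rw [← htw] at hw
    exact half_gaussSum_mul_mem_periodLattice_of_mem_charTwist _ hNdvd' h16 hχ hprim D'.f
      (fun x ↦ ⟨1, 3, 0, sum_χ₄_modularSymbol_of_half D'.f hhalf' x⟩) hw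

/-- **imc's landed conjecture `MinusOneTwistLatticeRotation` is a THEOREM**: on every same-level
`χ₋₄`-orbit with `2⁴ ∣ N` (`W ⊗ χ₋₄ ~ W′`; `D`, `D′` ANY `Γ₀`-modular-parametrisation data),
`z ∈ Λ(f_{W′}) ⟺ i·z ∈ Λ(f_W)` — i.e. `Λ(f_{W′}) = i·Λ(f_W)` exactly.  Proof: §15–§16 both ways
(`(g(χ₄)/2)·Λ(f′) ⊆ Λ(f)`, `(g(χ₄)/2)·Λ(f) ⊆ Λ(f′)`) with `(g(χ₄)/2)² = −1`, so `g(χ₄)/2 = ±i`.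
[cite: Stevens1989, Lemma (5.4) p. 97] [cite: Cremona1997, §2.8] -/
theorem minusOneTwistLatticeRotation_holds : MinusOneTwistLatticeRotation := by
  intro W W' _ _ _ _ _ _ D D' h16 hN hiso z
  have h16' : 4 ^ 2 ∣ W.conductorNorm ℤ := by norm_num at h16 ⊢; exact h16
  obtain ⟨h₁, h₂⟩ := half_gaussSum_χ₄_mul_mem_periodLattice_twoSided D D' h16' hN hiso
  have hs : (gaussSum (ZMod.χ₄.ringHomComp (Int.castRingHom ℂ)) (ZMod.stdAddChar (N := 4)) / 2) ^ 2 =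
      Complex.I ^ 2 := by
    rw [div_pow, gaussSum_χ₄_ringHomComp_sq, Complex.I_sq]; norm_num
  rcases sq_eq_sq_iff_eq_or_eq_neg.mp hs with hI | hI
  · constructor
    · intro hz
      have := h₁ z hz
      rwa [hI] at this
    · intro hz
      have := h₂ _ hz
      rw [hI, ← mul_assoc, Complex.I_mul_I, neg_one_mul] at this
      exact neg_mem_iff.mp this
  · constructor
    · intro hz
      have := h₁ z hz
      rw [hI, neg_mul] at this
      exact neg_mem_iff.mp this
    · intro hz
      have := h₂ _ hz
      rw [hI, neg_mul, ← mul_assoc, Complex.I_mul_I, neg_one_mul, neg_neg] at this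
      exact this

/-- **imc's landed `MinusOneTwistRigidity` REDUCED exactly like E-an-10 (§20)**: its clause 1 (optimal
rigidity, OPEN) and S-an-10 (print) imply it — the clauses `deg′ = deg` and `c′ = ±c` are §19's
`negOneCommutingOrbitManinDegEq_holds`; the hypothesis `¬ W ~ W′` is not needed. -/
theorem minusOneTwistRigidity_of_rigidity_of_discrEq (hR : NegOneOptimalTwistRigidity (2 ^ 5))
    (hS : NegOneTwistSameLevelDiscrEq (2 ^ 5)) : MinusOneTwistRigidity := by
  intro W W' _ _ _ _ _ _ D D' hD hD' h32 hN hiso _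
  obtain ⟨u, hu⟩ := hR W W' D D' hD hD' h32 hN hiso
  have h16 : 16 ∣ W.conductorNorm ℤ := dvd_trans (by norm_num) h32
  have key := negOneCommutingOrbitManinDegEq_holds dvd_rfl W W' u D D' h16 hN hu hD hD'
    (hS W W' u h32 hN hu)
  exact ⟨⟨u, hu⟩, key.2, key.1⟩

end LatticeRotation

end Summit.BirchSwinnertonDyer.Rank1Residual.ManinAdditive
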